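import Literature.MathematicalPhysics.QuantumFieldTheory.YangMillsOS
import Literature.MathematicalPhysics.QuantumFieldTheory.WilsonTransferKernel
import Literature.MathematicalPhysics.QuantumFieldTheory.SlabTransferKernel
import Literature.MathematicalPhysics.QuantumFieldTheory.ConstructiveQFTWave0Proofs
import Literature.Analysis.OperatorTheory.ExpInnerProductKernelPositivity
import HarnessLib

/-!
# Stub `stub_sliceKernel` (T2) for the crux `WeakCouplingHypercubicLimit` (line `Sketch`)

Kernel facts of the transfer-matrix representation of Wilson's lattice gauge theory on `(ℤ/N)⁴` sliced
across time (Osterwalder–Seiler 1978 §§2–3; Lüscher 1977; Seiler LNP 159 Ch. 2), for a faithful unitary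
`r : LatticeRep G`, `β ≥ 0`, `K = wilsonSliceKernel r.ρ β` on `GaugeConfig 3 N G`: the factors `exp(−β S_tm)`,
`exp(−β S₃/2)` are measurable and `≤ 1` (`Re tr M ≤ n` for unitary `M`); `K` is a positive multiple of
`SlabTransferKernel.sliceKernel r.ρ β β` (continuous, strictly positive, symmetric), `K ≤ 1`; and `K` is OF
POSITIVE TYPE (Lüscher): fold the half-weights into `F = f e^{−βS₃/2}`, double the temporal links `g = a/b`,
substitute `U ↦ U^a`, `U' ↦ U'^b` (skew-product measure preservation; `S_tm(U^a, a/b, U'^b) = S_tm(U, 1, U')`);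
Fubini gives `∫∫ (PF) k₀ (PF) ≥ 0` for the gauge average `PF` and the feature-form kernel
`k₀ = exp(−β S_tm(·,1,·)) = e^{−c} exp(β Σ (Re Re + Im Im))` (`integral_mul_exp_sum_mul_mul_nonneg`); the
measure theory of this step is the abstract lemma `integral_integral_fibreAverage_nonneg`.
-/

noncomputable section

open scoped BigOperators Topology InnerProductSpace
open MeasureTheory Filter
open Literature.MathematicalPhysics.QuantumFieldTheory Literature.MathematicalPhysics.QuantumLattice
open Literature.MathematicalPhysics.AQFT

namespace Summit.QuantumFields.YangMills.Theorems.WeakCouplingHypercubicLimit.TraceNormColdPressure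

open Literature.Barriers.QuantumFields Literature.Analysis.OperatorTheory Function

section Abstract

variable {X A : Type*} [MeasurableSpace X] [MeasurableSpace A]

/-- A measurable real function bounded by `1` is integrable for a finite measure. [folklore] -/
private theorem integrable_of_abs_le_one {μ : Measure X} [IsFiniteMeasure μ] {f : X → ℝ}
    (hf : Measurable f) (h1 : ∀ x, |f x| ≤ 1) : Integrable f μ :=
  (integrable_const (1 : ℝ)).mono' hf.aestronglyMeasurable
    (Eventually.of_forall fun x => (Real.norm_eq_abs _).trans_le (h1 x))

/-- `|a b c| ≤ 1` if `|a|, |b|, |c| ≤ 1`. [folklore] -/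
private theorem abs_mul_mul_le_one {a b c : ℝ} (ha : |a| ≤ 1) (hb : |b| ≤ 1) (hc : |c| ≤ 1) :
    |a * b * c| ≤ 1 := by
  rw [abs_mul, abs_mul]
  exact mul_le_one₀ (mul_le_one₀ ha (abs_nonneg _) hb) (abs_nonneg _) hc

/-- The average of a function bounded by `1` over a probability measure is bounded by `1`. [folklore] -/
private theorem abs_integral_le_one {μ : Measure X} [IsProbabilityMeasure μ] {f : X → ℝ}
    (h1 : ∀ x, |f x| ≤ 1) : |∫ x, f x ∂μ| ≤ 1 := by
  have h := norm_integral_le_of_norm_le_const (μ := μ) (f := f) (C := 1)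
    (Eventually.of_forall fun x => (Real.norm_eq_abs _).trans_le (h1 x))
  rwa [probReal_univ, mul_one, Real.norm_eq_abs] at h

/-- **Positivity transfer by fibre doubling and gauge averaging.**  `μ`, `ν` probability measures (slices,
fibres); `T a` a measurable family of `μ`-preserving maps; `D` pushes `ν ⊗ ν` to `ν`; `k` a measurable weight
bounded by `1` with `k(T a x, D(a,b), T b y) = k₀(x,y)`, `k₀` of positive type.  Then for measurable `|F| ≤ 1`,
`∫∫ F(x) (∫ k(x,a,y) dν) F(y) dμ dμ = ∫ (PF)(x) k₀(x,y) (PF)(y) d(μ ⊗ μ) ≥ 0`, `PF(x) = ∫ F(T a x) dν(a)` (Fubini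
over `(ν ⊗ ν) ⊗ (μ ⊗ μ)` and the substitution `(a, b, x, y) ↦ (a, b, T a x, T b y)`). [folklore] -/
private theorem integral_integral_fibreAverage_nonneg (μ : Measure X) (ν : Measure A)
    [IsProbabilityMeasure μ] [IsProbabilityMeasure ν]
    (T : A → X → X) (hTm : Measurable fun q : A × X => T q.1 q.2)
    (hT : ∀ a, MeasurePreserving (T a) μ μ)
    (D : A × A → A) (hD : MeasurePreserving D (ν.prod ν) ν)
    (F : X → ℝ) (hF : Measurable F) (hF1 : ∀ x, |F x| ≤ 1)
    (k : X → A → X → ℝ) (hk : Measurable fun q : X × A × X => k q.1 q.2.1 q.2.2)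
    (hk1 : ∀ x a y, |k x a y| ≤ 1)
    (k₀ : X × X → ℝ) (hk₀ : Measurable k₀) (hk₀1 : ∀ z, |k₀ z| ≤ 1)
    (hkT : ∀ (p : A × A) (z : X × X), k (T p.1 z.1) (D p) (T p.2 z.2) = k₀ z)
    (hpos : ∀ φ : X → ℝ, Measurable φ → (∀ x, |φ x| ≤ 1) →
      0 ≤ ∫ z, φ z.1 * k₀ z * φ z.2 ∂(μ.prod μ)) :
    0 ≤ ∫ x, ∫ y, F x * (∫ a, k x a y ∂ν) * F y ∂μ ∂μ := by
  have hM : Measurable fun z : X × X => ∫ a, k z.1 a z.2 ∂ν := by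
    have h : Measurable fun q : (X × X) × A => k q.1.1 q.2 q.1.2 :=
      hk.comp (measurable_fst.fst.prodMk (measurable_snd.prodMk measurable_fst.snd))
    exact (h.stronglyMeasurable.integral_prod_right' (ν := ν)).measurable
  have hM1 : ∀ z : X × X, |∫ a, k z.1 a z.2 ∂ν| ≤ 1 := fun z => abs_integral_le_one fun a => hk1 _ _ _
  have h1 : ∫ x, ∫ y, F x * (∫ a, k x a y ∂ν) * F y ∂μ ∂μ =
      ∫ z, F z.1 * (∫ a, k z.1 a z.2 ∂ν) * F z.2 ∂(μ.prod μ) :=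
    (integral_prod (μ := μ) (ν := μ) (fun z : X × X => F z.1 * (∫ a, k z.1 a z.2 ∂ν) * F z.2)
      (integrable_of_abs_le_one (μ := μ.prod μ)
        (((hF.comp measurable_fst).mul hM).mul (hF.comp measurable_snd))
        fun z => abs_mul_mul_le_one (hF1 _) (hM1 z) (hF1 _))).symm
  have hΨ : Measurable fun q : (A × A) × (X × X) => F q.2.1 * k q.2.1 (D q.1) q.2.2 * F q.2.2 :=
    ((hF.comp measurable_snd.fst).mul (hk.comp (measurable_snd.fst.prodMk
      ((hD.measurable.comp measurable_fst).prodMk measurable_snd.snd)))).mul (hF.comp measurable_snd.snd)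
  have h2 : ∀ z : X × X, F z.1 * (∫ a, k z.1 a z.2 ∂ν) * F z.2 =
      ∫ p, F z.1 * k z.1 (D p) z.2 * F z.2 ∂(ν.prod ν) := fun z => by
    have hkz : Measurable fun a => k z.1 a z.2 :=
      hk.comp (measurable_const.prodMk (measurable_id.prodMk measurable_const))
    have h3 := integral_map_of_stronglyMeasurable (μ := ν.prod ν) hD.measurable hkz.stronglyMeasurable
    rw [hD.map_eq] at h3
    rw [integral_mul_const, integral_const_mul, ← h3]
  have h2' : ∫ z, F z.1 * (∫ a, k z.1 a z.2 ∂ν) * F z.2 ∂(μ.prod μ) =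
      ∫ q, F q.2.1 * k q.2.1 (D q.1) q.2.2 * F q.2.2 ∂((ν.prod ν).prod (μ.prod μ)) := by
    rw [integral_prod_symm _ (integrable_of_abs_le_one (μ := (ν.prod ν).prod (μ.prod μ)) hΨ
      fun q => abs_mul_mul_le_one (hF1 _) (hk1 _ _ _) (hF1 _))]
    exact integral_congr_ae (Eventually.of_forall h2)
  have hΘ : MeasurePreserving
      (fun q : (A × A) × (X × X) => (q.1, (T q.1.1 q.2.1, T q.1.2 q.2.2)))
      ((ν.prod ν).prod (μ.prod μ)) ((ν.prod ν).prod (μ.prod μ)) := by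
    refine (MeasurePreserving.id _).skew_product
      (g := fun (p : A × A) (z : X × X) => (T p.1 z.1, T p.2 z.2)) ?_
      (Eventually.of_forall fun p => ((hT p.1).prod (hT p.2)).map_eq)
    exact (hTm.comp (measurable_fst.fst.prodMk measurable_snd.fst)).prodMk
      (hTm.comp (measurable_fst.snd.prodMk measurable_snd.snd))
  have hΨ' : Measurable fun q : (A × A) × (X × X) =>
      F (T q.1.1 q.2.1) * k₀ q.2 * F (T q.1.2 q.2.2) :=
    ((hF.comp (hTm.comp (measurable_fst.fst.prodMk measurable_snd.fst))).mul
      (hk₀.comp measurable_snd)).mul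
      (hF.comp (hTm.comp (measurable_fst.snd.prodMk measurable_snd.snd)))
  have h3 : ∫ q, F q.2.1 * k q.2.1 (D q.1) q.2.2 * F q.2.2 ∂((ν.prod ν).prod (μ.prod μ)) =
      ∫ q, F (T q.1.1 q.2.1) * k₀ q.2 * F (T q.1.2 q.2.2) ∂((ν.prod ν).prod (μ.prod μ)) := by
    calc ∫ q, F q.2.1 * k q.2.1 (D q.1) q.2.2 * F q.2.2 ∂((ν.prod ν).prod (μ.prod μ))
        = ∫ q, F q.2.1 * k q.2.1 (D q.1) q.2.2 * F q.2.2
            ∂(Measure.map (fun q : (A × A) × (X × X) => (q.1, (T q.1.1 q.2.1, T q.1.2 q.2.2)))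
              ((ν.prod ν).prod (μ.prod μ))) := by rw [hΘ.map_eq]
      _ = ∫ q, F (T q.1.1 q.2.1) * k (T q.1.1 q.2.1) (D q.1) (T q.1.2 q.2.2) * F (T q.1.2 q.2.2)
            ∂((ν.prod ν).prod (μ.prod μ)) :=
          integral_map_of_stronglyMeasurable hΘ.measurable hΨ.stronglyMeasurable
      _ = ∫ q, F (T q.1.1 q.2.1) * k₀ q.2 * F (T q.1.2 q.2.2) ∂((ν.prod ν).prod (μ.prod μ)) := by
          simp_rw [hkT]
  have h4 : ∫ q, F (T q.1.1 q.2.1) * k₀ q.2 * F (T q.1.2 q.2.2) ∂((ν.prod ν).prod (μ.prod μ)) =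
      ∫ z, (∫ a, F (T a z.1) ∂ν) * k₀ z * (∫ a, F (T a z.2) ∂ν) ∂(μ.prod μ) := by
    rw [integral_prod_symm _ (integrable_of_abs_le_one (μ := (ν.prod ν).prod (μ.prod μ)) hΨ'
      fun q => abs_mul_mul_le_one (hF1 _) (hk₀1 _) (hF1 _))]
    refine integral_congr_ae (Eventually.of_forall fun z => ?_)
    show ∫ p, F (T p.1 z.1) * k₀ z * F (T p.2 z.2) ∂(ν.prod ν) = _
    simp_rw [mul_assoc, mul_left_comm _ (k₀ z)]
    rw [integral_const_mul, integral_prod_mul (fun a => F (T a z.1)) (fun b => F (T b z.2))]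
  have hP : Measurable fun x => ∫ a, F (T a x) ∂ν :=
    ((hF.comp (hTm.comp (measurable_snd.prodMk measurable_fst))).stronglyMeasurable.integral_prod_right'
      (ν := ν)).measurable
  rw [h1, h2', h3, h4]
  exact hpos _ hP fun x => abs_integral_le_one fun a => hF1 _

end Abstract

section Lattice

variable {G : Type*} [Group G] {n : ℕ} (ρ : G →* Matrix (Fin n) (Fin n) ℂ) {N : ℕ} [NeZero N]

/-- `exp(−β S_tm) ≤ 1` for `β ≥ 0` and unitary `ρ`: `S_tm ≥ 0` termwise, as `Re tr M ≤ ‖tr M‖ ≤ n` for a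
unitary `n × n` matrix `M`. [folklore] -/
private theorem exp_sliceTemporalAction_le_one (hρu : ∀ g, ρ g ∈ Matrix.unitaryGroup (Fin n) ℂ)
    {β : ℝ} (hβ : 0 ≤ β) (U : GaugeConfig 3 N G) (g : Site 3 N → G) (U' : GaugeConfig 3 N G) :
    Real.exp (-(β * sliceTemporalAction ρ U g U')) ≤ 1 :=
  Real.exp_le_one_iff.2 (neg_nonpos.2 (mul_nonneg hβ (Finset.sum_nonneg fun _ _ =>
    Finset.sum_nonneg fun _ _ => sub_nonneg.2 ((Complex.re_le_norm _).trans
      (FiniteTemperature.norm_trace_le_of_mem_unitaryGroup (hρu _))))))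

/-- `exp(−β S₃/2) ≤ 1` for `β ≥ 0` and unitary `ρ` (`S₃ ≥ 0` termwise). [folklore] -/
private theorem exp_wilsonAction_le_one {d : ℕ} (hρu : ∀ g, ρ g ∈ Matrix.unitaryGroup (Fin n) ℂ)
    {β : ℝ} (hβ : 0 ≤ β) (U : GaugeConfig d N G) : Real.exp (-(β * wilsonAction ρ U / 2)) ≤ 1 :=
  Real.exp_le_one_iff.2 (neg_nonpos.2 (div_nonneg (mul_nonneg hβ (Finset.sum_nonneg fun _ _ => sub_nonneg.2
    ((Complex.re_le_norm _).trans (FiniteTemperature.norm_trace_le_of_mem_unitaryGroup (hρu _))))) zero_le_two))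

/-- `S₃ = n · #plaquettes − magSum` (the spatial plaquette sum of `SlabTransferKernel`). [folklore] -/
private theorem wilsonAction_eq_sub_magSum {d : ℕ} (U : GaugeConfig d N G) :
    wilsonAction ρ U = (∑ _p : Plaquette d N, (n : ℝ)) - magSum ρ U := by
  simp only [wilsonAction, magSum, Finset.sum_sub_distrib, Fintype.sum_prod_type]
  rfl

/-- `S_tm = n · 3N³ − elecSum` (the temporal plaquette sum of `SlabTransferKernel`). [folklore] -/
private theorem sliceTemporalAction_eq_sub_elecSum (U : GaugeConfig 3 N G) (g : Site 3 N → G)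
    (U' : GaugeConfig 3 N G) :
    sliceTemporalAction ρ U g U' = (∑ _x : Site 3 N, ∑ _i : Fin 3, (n : ℝ)) - elecSum ρ U g U' := by
  simp only [sliceTemporalAction, elecSum, Finset.sum_sub_distrib]
  rfl

/-- **Gauge covariance of the temporal plaquette energy**: `S_tm(U^a, a b⁻¹, U'^b) = S_tm(U, 1, U')`
(the temporal plaquettes become conjugates; cyclicity of the trace). [folklore] -/
private theorem sliceTemporalAction_gaugeTransform_div (a b : Site 3 N → G)
    (U U' : GaugeConfig 3 N G) :
    sliceTemporalAction ρ (gaugeTransform a U) (a / b) (gaugeTransform b U') =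
      sliceTemporalAction ρ U 1 U' := by
  unfold sliceTemporalAction
  refine Finset.sum_congr rfl fun x _ => Finset.sum_congr rfl fun i _ => ?_
  simp only [gaugeTransform, Pi.div_apply, Pi.one_apply, inv_one, one_mul, mul_one]
  have h : a x / b x * (b x * U' (x, i) * (b (Site.shift x i))⁻¹) *
      (a (Site.shift x i) / b (Site.shift x i))⁻¹ * (a x * U (x, i) * (a (Site.shift x i))⁻¹)⁻¹ =
      (a x)⁻¹⁻¹ * (U' (x, i) * (U (x, i))⁻¹) * (a x)⁻¹ := by
    simp only [div_eq_mul_inv]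
    group
  rw [h, FiniteTemperature.trace_re_rep_conj]

/-- `Re tr ρ(h g⁻¹) = Σ_{k,l} (Re ρ(g)_{kl} Re ρ(h)_{kl} + Im ρ(g)_{kl} Im ρ(h)_{kl})` for a unitary `ρ`
(`ρ(g⁻¹) = ρ(g)ᴴ` and the Hilbert–Schmidt pairing in real coordinates). [folklore] -/
private theorem trace_re_rep_mul_inv_eq_sum (hρu : ∀ g, ρ g ∈ Matrix.unitaryGroup (Fin n) ℂ)
    (g h : G) : (ρ (h * g⁻¹)).trace.re =
      ∑ k, ∑ l, ((ρ g k l).re * (ρ h k l).re + (ρ g k l).im * (ρ h k l).im) := by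
  rw [map_mul, FiniteTemperature.rep_inv_eq_star ρ hρu, Matrix.trace_mul_comm,
    FiniteTemperature.trace_star_mul_eq_sum, Complex.re_sum]
  refine Finset.sum_congr rfl fun k _ => ?_
  rw [Complex.re_sum]
  refine Finset.sum_congr rfl fun l _ => ?_
  rw [Complex.mul_re, Complex.conj_re, Complex.conj_im]
  ring

/-- **The un-averaged kernel in feature form**: `S_tm(U, 1, U') = const − Σ_{e,k,l} (Re Re + Im Im)` of the
matrix entries of `ρ(U_e)`, `ρ(U'_e)`. [folklore] -/
private theorem sliceTemporalAction_one (hρu : ∀ g, ρ g ∈ Matrix.unitaryGroup (Fin n) ℂ)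
    (U U' : GaugeConfig 3 N G) :
    sliceTemporalAction ρ U 1 U' = (∑ _x : Site 3 N, ∑ _i : Fin 3, (n : ℝ)) -
      ∑ t : Edge 3 N × Fin n × Fin n, ((ρ (U t.1) t.2.1 t.2.2).re * (ρ (U' t.1) t.2.1 t.2.2).re +
        (ρ (U t.1) t.2.1 t.2.2).im * (ρ (U' t.1) t.2.1 t.2.2).im) := by
  simp only [sliceTemporalAction, Pi.one_apply, inv_one, one_mul, mul_one, Finset.sum_sub_distrib,
    trace_re_rep_mul_inv_eq_sum ρ hρu, Fintype.sum_prod_type]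

variable [TopologicalSpace G] [IsTopologicalGroup G]

/-- Joint continuity of the temporal plaquette energy in (slice, temporal links, slice). [folklore] -/
private theorem continuous_sliceTemporalAction (hρ : Continuous ρ) :
    Continuous fun q : GaugeConfig 3 N G × (Site 3 N → G) × GaugeConfig 3 N G =>
      sliceTemporalAction ρ q.1 q.2.1 q.2.2 := by
  have h := (continuous_elecSum (d := 3) (L := N) ρ hρ).comp
    ((continuous_fst.prodMk (continuous_snd.comp continuous_snd)).prodMk
      (continuous_fst.comp continuous_snd) :
      Continuous fun q : GaugeConfig 3 N G × (Site 3 N → G) × GaugeConfig 3 N G =>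
        ((q.1, q.2.2), q.2.1))
  simp_rw [sliceTemporalAction_eq_sub_elecSum]
  exact continuous_const.sub h

omit [NeZero N] in
/-- Joint continuity of the gauge transformation `(a, U) ↦ U^a`. [folklore] -/
private theorem continuous_gaugeTransform {d : ℕ} :
    Continuous fun q : (Site d N → G) × GaugeConfig d N G => gaugeTransform q.1 q.2 :=
  continuous_pi fun e => (((continuous_apply e.1).comp continuous_fst).mul
    ((continuous_apply e).comp continuous_snd)).mul
    ((continuous_apply (Site.shift e.1 e.2)).comp continuous_fst).inv

variable [CompactSpace G] [MeasurableSpace G] [BorelSpace G]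

/-- **`wilsonSliceKernel ρ β = c · sliceKernel ρ β β`** with the positive constant
`c = e^{−β n #P₃/2} e^{−β n 3N³} e^{−β n #P₃/2}` (the `n`'s of `Re tr(1 − ρ(U_P))`). [folklore] -/
private theorem exists_wilsonSliceKernel_eq_mul_sliceKernel (β : ℝ) :
    ∃ c : ℝ, 0 < c ∧ ∀ U U' : GaugeConfig 3 N G,
      wilsonSliceKernel ρ β U U' = c * sliceKernel ρ β β U U' := by
  refine ⟨Real.exp (-(β * (∑ _p : Plaquette 3 N, (n : ℝ)) / 2)) *
      Real.exp (-(β * ∑ _x : Site 3 N, ∑ _i : Fin 3, (n : ℝ))) *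
      Real.exp (-(β * (∑ _p : Plaquette 3 N, (n : ℝ)) / 2)), by positivity, fun U U' => ?_⟩
  have hE : ∀ g : Site 3 N → G, Real.exp (-(β * sliceTemporalAction ρ U g U')) =
      Real.exp (-(β * ∑ _x : Site 3 N, ∑ _i : Fin 3, (n : ℝ))) *
        Real.exp (β * elecSum ρ U g U') := fun g => by
    rw [sliceTemporalAction_eq_sub_elecSum, ← Real.exp_add]; congr 1; ring
  have hM : ∀ V : GaugeConfig 3 N G, Real.exp (-(β * wilsonAction ρ V / 2)) =
      Real.exp (-(β * (∑ _p : Plaquette 3 N, (n : ℝ)) / 2)) * Real.exp (β / 2 * magSum ρ V) :=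
    fun V => by rw [wilsonAction_eq_sub_magSum, ← Real.exp_add]; congr 1; ring
  unfold wilsonSliceKernel sliceKernel
  simp_rw [hE]
  rw [integral_const_mul, hM U, hM U']
  ring

variable [SecondCountableTopology G]

/-- **Integral positive-definiteness of the un-averaged kernel** `exp(−β S_tm(U, 1, U'))`, `β ≥ 0`, against
bounded measurable functions of the slice: `integral_mul_exp_sum_mul_mul_nonneg` with the real feature map =
real and imaginary parts of the matrix entries of all `ρ(U_e)` (bounded by `1`). [folklore] -/
private theorem posType_exp_sliceTemporalAction_one (hρ : Continuous ρ)
    (hρu : ∀ g, ρ g ∈ Matrix.unitaryGroup (Fin n) ℂ) {β : ℝ} (hβ : 0 ≤ β)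
    (φ : GaugeConfig 3 N G → ℝ) (hφ : Measurable φ) (hφ1 : ∀ U, |φ U| ≤ 1) :
    0 ≤ ∫ z, φ z.1 * Real.exp (-(β * sliceTemporalAction ρ z.1 1 z.2)) * φ z.2
      ∂((Measure.pi fun _ : Edge 3 N => haarProbability G).prod (Measure.pi fun _ : Edge 3 N => haarProbability G)) := by
  obtain ⟨p, ⟨e⟩⟩ := Finite.exists_equiv_fin ((Edge 3 N × Fin n × Fin n) ⊕ (Edge 3 N × Fin n × Fin n))
  obtain ⟨w, hw⟩ : ∃ w : (Edge 3 N × Fin n × Fin n) ⊕ (Edge 3 N × Fin n × Fin n) →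
      GaugeConfig 3 N G → ℝ, w = Sum.elim (fun t U => (ρ (U t.1) t.2.1 t.2.2).re)
        (fun t U => (ρ (U t.1) t.2.1 t.2.2).im) := ⟨_, rfl⟩
  have hwm : ∀ s, Measurable (w s) := by
    rw [hw]; rintro (t | t)
    · exact (Complex.continuous_re.comp ((hρ.comp (continuous_apply t.1)).matrix_elem t.2.1 t.2.2)).measurable
    · exact (Complex.continuous_im.comp ((hρ.comp (continuous_apply t.1)).matrix_elem t.2.1 t.2.2)).measurable
  have hw1 : ∀ s U, |w s U| ≤ 1 := by
    rw [hw]; rintro (t | t) U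
    · exact (Complex.abs_re_le_norm _).trans (entry_norm_bound_of_unitary (hρu _) _ _)
    · exact (Complex.abs_im_le_norm _).trans (entry_norm_bound_of_unitary (hρu _) _ _)
  have hS : ∀ U U' : GaugeConfig 3 N G, -(β * sliceTemporalAction ρ U 1 U') =
      -(β * ∑ _x : Site 3 N, ∑ _i : Fin 3, (n : ℝ)) + β * ∑ j, w (e.symm j) U * w (e.symm j) U' := by
    intro U U'
    rw [Equiv.sum_comp e.symm (fun s => w s U * w s U'), Fintype.sum_sum_type,
      sliceTemporalAction_one ρ hρu U U', ← Finset.sum_add_distrib]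
    simp only [hw, Sum.elim_inl, Sum.elim_inr]
    ring
  have hexp : ∀ z : GaugeConfig 3 N G × GaugeConfig 3 N G,
      φ z.1 * Real.exp (-(β * sliceTemporalAction ρ z.1 1 z.2)) * φ z.2 =
        Real.exp (-(β * ∑ _x : Site 3 N, ∑ _i : Fin 3, (n : ℝ))) *
          (φ z.1 * Real.exp (β * ∑ j, w (e.symm j) z.1 * w (e.symm j) z.2) * φ z.2) := fun z => by
    rw [hS, Real.exp_add]; ring
  simp_rw [hexp]
  rw [integral_const_mul]
  exact mul_nonneg (Real.exp_pos _).le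
    (integral_mul_exp_sum_mul_mul_nonneg _ (fun U j => w (e.symm j) U) (fun j => hwm _) 1
      (fun U j => hw1 _ _) β hβ φ hφ 1 hφ1)

/-- **The Wilson slice kernel is of positive type** against bounded measurable functions, `β ≥ 0`
(Lüscher 1977; Osterwalder–Seiler 1978 §2): `∫∫ f(U) K(U,U') f(U') dμ dμ ≥ 0` — the half-weights
`e^{−βS₃/2}` folded into `f`, `integral_integral_fibreAverage_nonneg` with the gauge transformations as
fibre action, `(a, b) ↦ a / b` as doubling map and `exp(−β S_tm(·, 1, ·))` as un-averaged kernel. [folklore] -/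
private theorem posType_wilsonSliceKernel (hρ : Continuous ρ)
    (hρu : ∀ g, ρ g ∈ Matrix.unitaryGroup (Fin n) ℂ) {β : ℝ} (hβ : 0 ≤ β)
    (f : GaugeConfig 3 N G → ℝ) (hf : Measurable f) (hf1 : ∀ U, |f U| ≤ 1) :
    0 ≤ ∫ U, ∫ U', f U * wilsonSliceKernel ρ β U U' * f U'
      ∂(Measure.pi fun _ : Edge 3 N => haarProbability G) ∂(Measure.pi fun _ : Edge 3 N => haarProbability G) := by
  have hF : Measurable fun U : GaugeConfig 3 N G => f U * Real.exp (-(β * wilsonAction ρ U / 2)) :=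
    hf.mul (((WilsonRP.measurable_wilsonAction ρ hρ).const_mul β).div_const 2).neg.exp
  have hF1 : ∀ U : GaugeConfig 3 N G, |f U * Real.exp (-(β * wilsonAction ρ U / 2))| ≤ 1 := fun U => by
    rw [abs_mul, Real.abs_exp]
    exact mul_le_one₀ (hf1 U) (Real.exp_pos _).le (exp_wilsonAction_le_one ρ hρu hβ U)
  have hk : Measurable fun q : GaugeConfig 3 N G × (Site 3 N → G) × GaugeConfig 3 N G =>
      Real.exp (-(β * sliceTemporalAction ρ q.1 q.2.1 q.2.2)) :=
    ((continuous_sliceTemporalAction ρ hρ).measurable.const_mul β).neg.exp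
  have hk1 : ∀ (U : GaugeConfig 3 N G) (g : Site 3 N → G) (U' : GaugeConfig 3 N G),
      |Real.exp (-(β * sliceTemporalAction ρ U g U'))| ≤ 1 := fun U g U' =>
    (Real.abs_exp _).trans_le (exp_sliceTemporalAction_le_one ρ hρu hβ U g U')
  have heq : ∀ U U' : GaugeConfig 3 N G, f U * wilsonSliceKernel ρ β U U' * f U' =
      (f U * Real.exp (-(β * wilsonAction ρ U / 2))) *
        (∫ g, Real.exp (-(β * sliceTemporalAction ρ U g U')) ∂(Measure.pi fun _ : Site 3 N => haarProbability G)) *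
        (f U' * Real.exp (-(β * wilsonAction ρ U' / 2))) := fun U U' => by
    unfold wilsonSliceKernel; ring
  have hD : MeasurePreserving (fun p : (Site 3 N → G) × (Site 3 N → G) => p.1 / p.2)
      ((Measure.pi fun _ : Site 3 N => haarProbability G).prod (Measure.pi fun _ : Site 3 N => haarProbability G)) (Measure.pi fun _ : Site 3 N => haarProbability G) :=
    (measurePreserving_fst (μ := Measure.pi fun _ : Site 3 N => haarProbability G) (ν := Measure.pi fun _ : Site 3 N => haarProbability G)).comp
      (measurePreserving_div_prod (Measure.pi fun _ : Site 3 N => haarProbability G) (Measure.pi fun _ : Site 3 N => haarProbability G))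
  have hk₀ : Measurable fun z : GaugeConfig 3 N G × GaugeConfig 3 N G =>
      Real.exp (-(β * sliceTemporalAction ρ z.1 1 z.2)) :=
    (((continuous_sliceTemporalAction ρ hρ).comp (continuous_fst.prodMk
      (continuous_const.prodMk continuous_snd))).measurable.const_mul β).neg.exp
  have hkT : ∀ (p : (Site 3 N → G) × (Site 3 N → G)) (z : GaugeConfig 3 N G × GaugeConfig 3 N G),
      Real.exp (-(β * sliceTemporalAction ρ (gaugeTransform p.1 z.1) (p.1 / p.2)
        (gaugeTransform p.2 z.2))) = Real.exp (-(β * sliceTemporalAction ρ z.1 1 z.2)) :=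
    fun p z => by rw [sliceTemporalAction_gaugeTransform_div]
  simp_rw [heq]
  exact integral_integral_fibreAverage_nonneg (Measure.pi fun _ : Edge 3 N => haarProbability G) (Measure.pi fun _ : Site 3 N => haarProbability G) gaugeTransform
    continuous_gaugeTransform.measurable (fun a => WilsonGauge.measurePreserving_gaugeTransform a)
    (fun p => p.1 / p.2) hD
    (fun U => f U * Real.exp (-(β * wilsonAction ρ U / 2))) hF hF1
    (fun U g U' => Real.exp (-(β * sliceTemporalAction ρ U g U'))) hk hk1
    (fun z => Real.exp (-(β * sliceTemporalAction ρ z.1 1 z.2))) hk₀ (fun z => hk1 _ _ _) hkT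
    (posType_exp_sliceTemporalAction_one ρ hρ hρu hβ)

end Lattice

/-- `stub_sliceKernel` (T2) — **the Wilson time-slice kernel is a bounded, symmetric, strictly positive, jointly
continuous kernel OF POSITIVE TYPE** (Lüscher 1977; Osterwalder–Seiler 1978 §§2–3; Seiler LNP 159 Ch. 2): for a
faithful unitary `r : LatticeRep G`, `β ≥ 0`, on `GaugeConfig 3 N G` with its product Haar probability measure,
the factors `exp(−β S_tm)`, `exp(−β S₃/2)` are measurable and `≤ 1`; `K = wilsonSliceKernel r.ρ β` is jointly
strongly measurable (continuous: a positive multiple of `sliceKernel r.ρ β β`; `G` is second countable through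
`r`), symmetric, `0 < K ≤ 1`, and of positive type (`posType_wilsonSliceKernel`). [folklore] -/
theorem stub_sliceKernel :
    ∀ (G : Type) [Group G] [TopologicalSpace G] [IsTopologicalGroup G] [CompactSpace G]
      [MeasurableSpace G] [BorelSpace G] (r : LatticeRep G) (N : ℕ) [NeZero N] (β : ℝ), 0 ≤ β →
    (Measurable fun q : GaugeConfig 3 N G × (Site 3 N → G) × GaugeConfig 3 N G =>
        Real.exp (-(β * sliceTemporalAction r.ρ q.1 q.2.1 q.2.2))) ∧
    (∀ (U : GaugeConfig 3 N G) (g : Site 3 N → G) (U' : GaugeConfig 3 N G),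
        Real.exp (-(β * sliceTemporalAction r.ρ U g U')) ≤ 1) ∧
    (Measurable fun U : GaugeConfig 3 N G => Real.exp (-(β * wilsonAction r.ρ U / 2))) ∧
    (∀ U : GaugeConfig 3 N G, Real.exp (-(β * wilsonAction r.ρ U / 2)) ≤ 1) ∧
    StronglyMeasurable (Function.uncurry (wilsonSliceKernel r.ρ β : GaugeConfig 3 N G → GaugeConfig 3 N G → ℝ)) ∧
    (∀ U U' : GaugeConfig 3 N G, wilsonSliceKernel r.ρ β U U' = wilsonSliceKernel r.ρ β U' U) ∧
    (∀ U U' : GaugeConfig 3 N G, 0 < wilsonSliceKernel r.ρ β U U' ∧ wilsonSliceKernel r.ρ β U U' ≤ 1) ∧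
    (∀ f : GaugeConfig 3 N G → ℝ, Measurable f → (∀ U, |f U| ≤ 1) →
        0 ≤ ∫ U, ∫ U', f U * wilsonSliceKernel r.ρ β U U' * f U'
          ∂(Measure.pi fun _ : Edge 3 N => haarProbability G) ∂(Measure.pi fun _ : Edge 3 N => haarProbability G)) := by
  intro G _ _ _ _ _ _ r N _ β hβ
  haveI : SecondCountableTopology G :=
    (r.continuous.isClosedEmbedding r.injective).isEmbedding.secondCountableTopology
  obtain ⟨c, hc, hK⟩ := exists_wilsonSliceKernel_eq_mul_sliceKernel (N := N) r.ρ β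
  have hKc : Continuous (uncurry (wilsonSliceKernel r.ρ β : GaugeConfig 3 N G → GaugeConfig 3 N G → ℝ)) :=
    (funext fun z => hK z.1 z.2 : uncurry (wilsonSliceKernel r.ρ β : GaugeConfig 3 N G → _ → ℝ) =
        fun z => c * uncurry (sliceKernel (d := 3) (L := N) r.ρ β β) z) ▸
      continuous_const.mul (continuous_sliceKernel (d := 3) (L := N) r.ρ r.continuous β β)
  refine ⟨((continuous_sliceTemporalAction r.ρ r.continuous).measurable.const_mul β).neg.exp,
    exp_sliceTemporalAction_le_one r.ρ r.mem_unitary hβ,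
    (((WilsonRP.measurable_wilsonAction r.ρ r.continuous).const_mul β).div_const 2).neg.exp,
    exp_wilsonAction_le_one r.ρ r.mem_unitary hβ, hKc.stronglyMeasurable, fun U U' => ?_,
    fun U U' => ⟨?_, ?_⟩, fun f hf hf1 => posType_wilsonSliceKernel r.ρ r.continuous r.mem_unitary hβ f hf hf1⟩
  · rw [hK, hK, sliceKernel_symm r.ρ r.mem_unitary]
  · rw [hK]
    exact mul_pos hc (sliceKernel_pos r.ρ r.continuous β β U U')
  · have h2 : ∫ g, Real.exp (-(β * sliceTemporalAction r.ρ U g U'))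
        ∂(Measure.pi fun _ : Site 3 N => haarProbability G) ≤ 1 :=
      (le_abs_self _).trans (abs_integral_le_one fun g =>
        (Real.abs_exp _).trans_le (exp_sliceTemporalAction_le_one r.ρ r.mem_unitary hβ U g U'))
    exact mul_le_one₀ (mul_le_one₀ (exp_wilsonAction_le_one r.ρ r.mem_unitary hβ U)
      (integral_nonneg fun g => (Real.exp_pos _).le) h2) (Real.exp_pos _).le
      (exp_wilsonAction_le_one r.ρ r.mem_unitary hβ U')

end Summit.QuantumFields.YangMills.Theorems.WeakCouplingHypercubicLimit.TraceNormColdPressure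

end
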